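import Summits.ResolutionOfSingularities.ResolutionOfSingularities.Theorems.MarkedTransferCampaignW24ReducedBridgePStep
import HarnessLib

/-!
# The LEVEL-`q` bridge at an ARBITRARY PRIME `p`, part 4: runs, box-confinement, and the `n = 1` slice of
# ⟨`Rescue.FiniteSupportStaysInBox_ours p`⟩ REDUCED TO IN-BOX EXHAUSTION OF ONE-VARIABLE REDUCED RUNS (HIRONAKA-L · cell `res-hironaka` ·
# slot W2.4 «bottom-member re-run»; the `p = 2` case, where res-L1-type-o6's death theorem discharges the hypothesis, is res-D-pv-020's
# `…ReducedBridgeQRun.lean`, `carrierStaysInBox_coe_fin_one_level`; NOT to be confused with res-D-pv-020's gen-4 `…ReducedBridgePRun.lean`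
# = the `e = 1` twin-carrier escape bridge `Φ_p G = x·G(x^p)` behind `¬ SomeDepthStaysInBox p`)

**HONEST FRAMING.** OURS throughout: kernel theorems connecting OURS objects of the cell (res-L1-k24's `CampaignW24.ReducedRun`, res-type-059's
`CampaignW24.StaysInBox/IsBottomRun/stepAt`, res-D-pv-031's persistence `Rescue.RD2Prime.isLowerClass_stepAt_of_isLowerClass`, res-D-pv-020's
`CampaignW24.ReducedBridge(P)`). Nothing below is a statement of H. Hironaka's manuscript [Hironaka2017] (lit key `paper:url-3343fd9e678b`),
nothing asserts that any statement of it holds, nothing is a claim about resolution of singularities in characteristic `p`; the manuscript stays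
«under review» (D-0012/D-0089). AI work, weaker than expert review. Written by res-D-pv-020 (W2.4 lineage), prompted by res-type-059's immortal
universal runs at `p = 5, 7` (p534226, p535754: death fails at odd `p`, in-box exhaustion at every depth holds for those witnesses).

## What is proved (`K` of characteristic `p`, `p` prime; `0 < e ≤ ℓ`; `q = p^e`; `F = Φ_{q,r₀} G + R`, passenger residues in
## `good ⊆ PairLTP p · r₀`, every `good` residue visible in the reference carrier)
* §1 `isLowerClass_of_resInP`; §2 `run_of_level(_digitOne)P`, `isLowerClass_run_of_levelP`, `staysInBox_of_level_of_reduced_exhaustion(_digitOne)P`: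
  in-box reduced exhaustion at depth `p^{ℓ−e}` ⇒ `StaysInBox p e ℓ X₀`.
* §3 THE REDUCTION: **`carrierStaysInBox_coe_fin_one_of_reduced_exhaustion (p) (hex) (e) (P : MvPolynomial (Fin 1) K) :
  Rescue.CarrierStaysInBox p e ↑P`**, where the HYPOTHESIS `hex` is spelled inline: every finitely supported `G ∈ K⟦t⟧` with `2 ≤ ord G` has its
  canonical reduced run EXHAUSTED IN BOX at INFINITELY MANY `p`-power depths (`∀ a₀, ∃ a ≥ a₀, ∃ i₁, (∀ i < i₁, canonRun p^a G i ≠ 0 ∧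
  2 ≤ ord < p^a) ∧ canonRun p^a G i₁ = 0`). At `p = 2` the hypothesis is res-L1-type-o6's `ReducedRun.reduced_exhaustion_of_two_le_order` (stronger form) and
  the conclusion is `…QRun`'s `carrierStaysInBox_coe_fin_one_level`; at odd `p` it is the OPEN reduced residual (death is false there:
  res-type-059), so this file settles NOTHING at odd `p` — it says exactly what the `n = 1` slice of the OURS premise needs from the reduced model.
Nothing is claimed for `n ≥ 2` or infinite support. Hypotheses: each theorem's own binders; no FACT-LIST fact, no DEFECT binder. Standard axioms only.
-/

noncomputable section

set_option linter.dupNamespace false -- mandated namespace of this single-conjunct summit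

namespace Summit.ResolutionOfSingularities.ResolutionOfSingularities.Theorems

namespace CampaignW24

namespace ReducedBridgeP

open Literature.AlgebraicGeometry.Hironaka2017.S08UnitMonomial (StandardExpression)
open Literature.AlgebraicGeometry.Hironaka2017.S09LLUED
open Literature.AlgebraicGeometry.Hironaka2017.S09LLUED.TopFrontier
open Literature.AlgebraicGeometry.Hironaka2017.S09LLUED.TopDeriv
open Literature.AlgebraicGeometry.Hironaka2017.S09LLUED.FrontierDrop (expo)
open Literature.AlgebraicGeometry.Resolution (adicOrder)
open Literature.RingTheory.MvPowerSeries (adicOrder_eq_order)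
open CampaignW21 (xs hasseD)
open Rescue.RD2Prime (isLowerClass_stepAt_of_isLowerClass)
open ReducedBridge

variable {K : Type} [Field K]

/-! ## §1 Passengers are of lower class -/

variable {p : ℕ} [hp : Fact p.Prime] [CharP K p]

/-- **Passengers are of LOWER CLASS** relative to every reference datum `X₀` (depth `ℓ₀ ≥ e > 0`) of `F₀ = Φ_{q,r₀} G₀ + R₀` (`G₀ ≠ 0`), provided
every `good` residue is visible in `F₀`: such a residue is carried by an effective summand of `X₀` with digits below those of `r₀`. [folklore] -/
theorem isLowerClass_of_resInP {e ℓ₀ : ℕ} {F₀ R₀ : MvPowerSeries (Fin 1) K} {G₀ : PowerSeries K} {r₀ : ℕ} {good : ℕ → Prop}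
    (X₀ : StandardExpression p (xs K 1) e ℓ₀ F₀) (hF₀ : F₀ = phiQ (p ^ e) (ppow_ne_zero p e) r₀ G₀ + R₀) (hr₀ : r₀ < p ^ e)
    (hR₀ : ResIn (p ^ e) good R₀) (hgood : ∀ ρ, good ρ → PairLTP p ρ r₀) (he : 0 < e) (hle₀ : e ≤ ℓ₀) (hG₀ : G₀ ≠ 0)
    (hvis : ∀ ρ, good ρ → ∃ d : Fin 1 →₀ ℕ, MvPowerSeries.coeff d F₀ ≠ 0 ∧ d 0 % p ^ e = ρ)
    {R : MvPowerSeries (Fin 1) K} (hR : ResIn (p ^ e) good R) : IsLowerClass X₀ R := by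
  obtain ⟨hα, hβ⟩ := alpha_beta_of_levelP X₀ hF₀ hr₀ hR₀ hgood he hle₀ hG₀
  intro m hm
  obtain ⟨d, hd, hdρ⟩ := hvis _ (hR m hm)
  obtain ⟨s, hs, r, hr⟩ := exists_mem_effSupport_of_coeff_ne_zero hle₀ X₀ hd
  obtain ⟨hss, hus⟩ := mem_effSupport.mp hs
  have hres : d 0 % p ^ e = s.1 0 + p * s.2.1 0 := residue_of_eqP X₀ he hss hr
  refine ⟨s, hss, hus, ?_, fun i => ?_⟩
  · rw [hα, hβ]
    refine pairKey_lt_of_pairLTPP X₀ hss ?_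
    rw [← hres, hdρ]
    exact hgood _ (hR m hm)
  · have hi : i = 0 := Subsingleton.elim _ _
    subst hi
    show m 0 % p ^ e = expo p e s 0 % p ^ e
    rw [expo_modP X₀ he hss, ← hres, hdρ]

/-! ## §2 Runs at level `e` and box-confinement from in-box reduced exhaustion -/

/-- **Run bridge at level `e` (bottom digit `≥ 2` at the start), up to the reduced death index**: the top residue class runs as res-L1-k24's
canonical reduced run at depth `p^{ℓ−e}`, the passenger keeps its residues in `good`. [folklore] -/
theorem run_of_levelP {e ℓ : ℕ} (he : 0 < e) (hle : e ≤ ℓ) {r₀ : ℕ} (hr₀ : r₀ < p ^ e) {good : ℕ → Prop}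
    (hgood : ∀ ρ, good ρ → PairLTP p ρ r₀) {G₀ : PowerSeries K} {R₀ : MvPowerSeries (Fin 1) K} (hR₀ : ResIn (p ^ e) good R₀)
    {N : ℕ} {εs : ℕ → MvPowerSeries (Fin 1) K} (h0 : εs 0 = phiQ (p ^ e) (ppow_ne_zero p e) r₀ G₀ + R₀)
    (hrun : IsBottomRun p e ℓ εs N) {i₁ : ℕ}
    (hpre : ∀ i < i₁, ReducedRun.canonRun (p ^ (ℓ - e)) G₀ i ≠ 0 ∧
      (2 : ℕ∞) ≤ PowerSeries.order (ReducedRun.canonRun (p ^ (ℓ - e)) G₀ i)) :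
    ∀ i ≤ N, i ≤ i₁ → ∃ Ri : MvPowerSeries (Fin 1) K, ResIn (p ^ e) good Ri ∧
      εs i = phiQ (p ^ e) (ppow_ne_zero p e) r₀ (ReducedRun.canonRun (p ^ (ℓ - e)) G₀ i) + Ri := by
  intro i
  induction i with
  | zero => exact fun _ _ => ⟨R₀, hR₀, h0⟩
  | succ i ih =>
    intro hi hi₁
    obtain ⟨Ri, hRi, hεi⟩ := ih (Nat.le_of_succ_le hi) (Nat.le_of_succ_le hi₁)
    obtain ⟨X, w, c, hX0, hsole, -, hw, hstep⟩ := hrun i hi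
    obtain ⟨hne, h2⟩ := hpre i hi₁
    have hfin : PowerSeries.order (ReducedRun.canonRun (p ^ (ℓ - e)) G₀ i) =
        ((PowerSeries.order (ReducedRun.canonRun (p ^ (ℓ - e)) G₀ i)).toNat : ℕ∞) :=
      (ENat.coe_toNat fun h => hne (PowerSeries.order_eq_top.mp h)).symm
    have h2k : 2 ≤ (PowerSeries.order (ReducedRun.canonRun (p ^ (ℓ - e)) G₀ i)).toNat := by
      rw [hfin] at h2
      exact_mod_cast h2
    obtain ⟨R', hR', hE'⟩ := stepAt_of_level_caseIP X hεi hr₀ hRi hgood he hle hX0 hfin h2k hsole hw c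
    exact ⟨R', hR', by rw [hstep, hE']; rfl⟩

/-- **Lower class persists along a legal run at level `e`** (res-D-pv-031's one-step persistence, iterated). [folklore] -/
theorem isLowerClass_run_of_levelP {e ℓ ℓ₀ : ℕ} (he : 0 < e) (hle : e ≤ ℓ) {F₀ : MvPowerSeries (Fin 1) K}
    (X₀ : StandardExpression p (xs K 1) e ℓ₀ F₀) {N : ℕ} {εs : ℕ → MvPowerSeries (Fin 1) K} (hrun : IsBottomRun p e ℓ εs N)
    {j₀ : ℕ} (hj₀ : IsLowerClass X₀ (εs j₀)) : ∀ j, j₀ ≤ j → j ≤ N → IsLowerClass X₀ (εs j) := by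
  intro j hj hjN
  obtain ⟨d, rfl⟩ := Nat.exists_eq_add_of_le hj
  induction d with
  | zero => exact hj₀
  | succ d ih =>
    obtain ⟨X, w, c, hX0, -, -, hw, hstep⟩ := hrun (j₀ + d) (by omega)
    rw [← add_assoc, hstep]
    exact isLowerClass_stepAt_of_isLowerClass X₀ he (ih (by omega) (by omega)) X hle hX0 hw c

/-- **Box-confinement at level `e` from in-box reduced exhaustion of the top residue class** (bottom digit `≥ 2` at the start): in-box states
`i < i₁` have bottom digit `< 2^{ℓ−e}`; the state `i₁` is the passenger alone, of lower class, and lower class persists. [folklore] -/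
theorem staysInBox_of_level_of_reduced_exhaustionP {e ℓ₀ ℓ : ℕ} (he : 0 < e) (hle : e ≤ ℓ) {r₀ : ℕ} (hr₀ : r₀ < p ^ e)
    {good : ℕ → Prop} (hgood : ∀ ρ, good ρ → PairLTP p ρ r₀) {G₀ : PowerSeries K} (hG₀ : G₀ ≠ 0) {F₀ R₀ : MvPowerSeries (Fin 1) K}
    (X₀ : StandardExpression p (xs K 1) e ℓ₀ F₀) (hF₀ : F₀ = phiQ (p ^ e) (ppow_ne_zero p e) r₀ G₀ + R₀)
    (hR₀ : ResIn (p ^ e) good R₀) (hle₀ : e ≤ ℓ₀)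
    (hvis : ∀ ρ, good ρ → ∃ d : Fin 1 →₀ ℕ, MvPowerSeries.coeff d F₀ ≠ 0 ∧ d 0 % p ^ e = ρ) {i₁ : ℕ}
    (hpre : ∀ i < i₁, ReducedRun.canonRun (p ^ (ℓ - e)) G₀ i ≠ 0 ∧
      (2 : ℕ∞) ≤ PowerSeries.order (ReducedRun.canonRun (p ^ (ℓ - e)) G₀ i) ∧
      PowerSeries.order (ReducedRun.canonRun (p ^ (ℓ - e)) G₀ i) < ((p ^ (ℓ - e) : ℕ) : ℕ∞))
    (hzero : ReducedRun.canonRun (p ^ (ℓ - e)) G₀ i₁ = 0) :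
    StaysInBox p e ℓ X₀ := by
  intro N εs h0 hrun hnl X hX0
  have h0' : εs 0 = phiQ (p ^ e) (ppow_ne_zero p e) r₀ G₀ + R₀ := by rw [h0, hF₀]
  rcases Nat.lt_or_ge N i₁ with hlt | hge
  · obtain ⟨RN, hRN, hεN⟩ :=
      run_of_levelP he hle hr₀ hgood hR₀ h0' hrun (fun i hi => ⟨(hpre i hi).1, (hpre i hi).2.1⟩) N le_rfl hlt.le
    obtain ⟨hne, -, hP⟩ := hpre N hlt
    set GN := ReducedRun.canonRun (p ^ (ℓ - e)) G₀ N with hGN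
    have hfin : PowerSeries.order GN = ((PowerSeries.order GN).toNat : ℕ∞) :=
      (ENat.coe_toNat fun h => hne (PowerSeries.order_eq_top.mp h)).symm
    rw [hfin] at hP
    exact (depthBox_iff_of_levelP X hεN hr₀ hRN hgood he hle hX0 hfin).mpr (by exact_mod_cast hP)
  · exfalso
    obtain ⟨Ri, hRi, hεi⟩ :=
      run_of_levelP he hle hr₀ hgood hR₀ h0' hrun (fun i hi => ⟨(hpre i hi).1, (hpre i hi).2.1⟩) i₁ hge le_rfl
    rw [hzero, phiQ_zero, zero_add] at hεi
    have hlow : IsLowerClass X₀ (εs i₁) := by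
      rw [hεi]; exact isLowerClass_of_resInP X₀ hF₀ hr₀ hR₀ hgood he hle₀ hG₀ hvis hRi
    exact hnl (isLowerClass_run_of_levelP he hle X₀ hrun hlow N hge le_rfl)

/-- **Run bridge at level `e`, bottom digit `1`**: after the forced Case-(III) first step the top class is `canonRun 2^{ℓ−e} G₁ (i−1)`,
`G₁ = canonStepIIIq 2^{ℓ−e} k̄ G₀`, `k̄ = q / r₀ + 1`, up to the reduced death index of `G₁`. [folklore] -/
theorem run_of_level_digitOneP {e ℓ : ℕ} (he : 0 < e) (hle : e ≤ ℓ) {r₀ : ℕ} (hr₀ : r₀ < p ^ e) (hr₀pos : 0 < r₀)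
    {good : ℕ → Prop} (hgood : ∀ ρ, good ρ → PairLTP p ρ r₀) {G₀ : PowerSeries K} (hk : PowerSeries.order G₀ = (1 : ℕ))
    {R₀ : MvPowerSeries (Fin 1) K} (hR₀ : ResIn (p ^ e) good R₀) {N : ℕ} {εs : ℕ → MvPowerSeries (Fin 1) K}
    (h0 : εs 0 = phiQ (p ^ e) (ppow_ne_zero p e) r₀ G₀ + R₀) (hrun : IsBottomRun p e ℓ εs N) {i₁ : ℕ}
    (hpre : ∀ i < i₁, ReducedRun.canonRun (p ^ (ℓ - e)) (ReducedRun.canonStepIIIq (p ^ (ℓ - e)) (p ^ e / r₀ + 1) G₀) i ≠ 0 ∧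
      (2 : ℕ∞) ≤ PowerSeries.order
        (ReducedRun.canonRun (p ^ (ℓ - e)) (ReducedRun.canonStepIIIq (p ^ (ℓ - e)) (p ^ e / r₀ + 1) G₀) i)) :
    ∀ i, i + 1 ≤ N → i ≤ i₁ → ∃ Ri : MvPowerSeries (Fin 1) K, ResIn (p ^ e) good Ri ∧
      εs (i + 1) = phiQ (p ^ e) (ppow_ne_zero p e) r₀
        (ReducedRun.canonRun (p ^ (ℓ - e)) (ReducedRun.canonStepIIIq (p ^ (ℓ - e)) (p ^ e / r₀ + 1) G₀) i) + Ri := by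
  intro i hi hi₁
  obtain ⟨X, w, c, hX0, hsole, -, hw, hstep⟩ := hrun 0 (by omega)
  obtain ⟨R₁, hR₁, hE₁⟩ := stepAt_of_level_caseIIIP X h0 hr₀ hr₀pos hR₀ hgood he hle hX0 hk hsole hw c
  have h1 : εs 1 = phiQ (p ^ e) (ppow_ne_zero p e) r₀ (ReducedRun.canonStepIIIq (p ^ (ℓ - e)) (p ^ e / r₀ + 1) G₀) + R₁ := by
    rw [hstep, hE₁]
  have hrun' : IsBottomRun p e ℓ (fun j => εs (j + 1)) i := fun j hj => hrun (j + 1) (by omega)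
  exact run_of_levelP he hle hr₀ hgood hR₁ h1 hrun' hpre i le_rfl hi₁

/-- **Box-confinement at level `e`, bottom digit `1`** (`ℓ ≥ e + 1`, `ord G₀ = 1`) from in-box reduced exhaustion of the second state.
[folklore] -/
theorem staysInBox_of_level_of_reduced_exhaustion_digitOneP {e ℓ₀ ℓ : ℕ} (he : 0 < e) (hle : e + 1 ≤ ℓ) {r₀ : ℕ} (hr₀ : r₀ < p ^ e)
    (hr₀pos : 0 < r₀) {good : ℕ → Prop} (hgood : ∀ ρ, good ρ → PairLTP p ρ r₀) {G₀ : PowerSeries K}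
    (hk : PowerSeries.order G₀ = (1 : ℕ)) {F₀ R₀ : MvPowerSeries (Fin 1) K} (X₀ : StandardExpression p (xs K 1) e ℓ₀ F₀)
    (hF₀ : F₀ = phiQ (p ^ e) (ppow_ne_zero p e) r₀ G₀ + R₀) (hR₀ : ResIn (p ^ e) good R₀) (hle₀ : e ≤ ℓ₀)
    (hvis : ∀ ρ, good ρ → ∃ d : Fin 1 →₀ ℕ, MvPowerSeries.coeff d F₀ ≠ 0 ∧ d 0 % p ^ e = ρ) {i₁ : ℕ}
    (hpre : ∀ i < i₁, ReducedRun.canonRun (p ^ (ℓ - e)) (ReducedRun.canonStepIIIq (p ^ (ℓ - e)) (p ^ e / r₀ + 1) G₀) i ≠ 0 ∧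
      (2 : ℕ∞) ≤ PowerSeries.order
        (ReducedRun.canonRun (p ^ (ℓ - e)) (ReducedRun.canonStepIIIq (p ^ (ℓ - e)) (p ^ e / r₀ + 1) G₀) i) ∧
      PowerSeries.order (ReducedRun.canonRun (p ^ (ℓ - e)) (ReducedRun.canonStepIIIq (p ^ (ℓ - e)) (p ^ e / r₀ + 1) G₀) i) <
        ((p ^ (ℓ - e) : ℕ) : ℕ∞))
    (hzero : ReducedRun.canonRun (p ^ (ℓ - e)) (ReducedRun.canonStepIIIq (p ^ (ℓ - e)) (p ^ e / r₀ + 1) G₀) i₁ = 0) :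
    StaysInBox p e ℓ X₀ := by
  have hle1 : e ≤ ℓ := by omega
  have hG₀ : G₀ ≠ 0 := fun h => by rw [h, PowerSeries.order_zero] at hk; exact ENat.top_ne_coe _ hk
  intro N εs h0 hrun hnl X hX0
  have h0' : εs 0 = phiQ (p ^ e) (ppow_ne_zero p e) r₀ G₀ + R₀ := by rw [h0, hF₀]
  rcases N with _ | M
  · exact (depthBox_iff_of_levelP X h0' hr₀ hR₀ hgood he hle1 hX0 hk).mpr (Nat.one_lt_pow (by omega) hp.out.one_lt)
  · rcases Nat.lt_or_ge M i₁ with hlt | hge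
    · obtain ⟨RM, hRM, hεM⟩ := run_of_level_digitOneP he hle1 hr₀ hr₀pos hgood hk hR₀ h0' hrun
        (fun i hi => ⟨(hpre i hi).1, (hpre i hi).2.1⟩) M le_rfl hlt.le
      obtain ⟨hne, -, hP⟩ := hpre M hlt
      set GM := ReducedRun.canonRun (p ^ (ℓ - e)) (ReducedRun.canonStepIIIq (p ^ (ℓ - e)) (p ^ e / r₀ + 1) G₀) M with hGM
      have hfin : PowerSeries.order GM = ((PowerSeries.order GM).toNat : ℕ∞) :=
        (ENat.coe_toNat fun h => hne (PowerSeries.order_eq_top.mp h)).symm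
      rw [hfin] at hP
      exact (depthBox_iff_of_levelP X hεM hr₀ hRM hgood he hle1 hX0 hfin).mpr (by exact_mod_cast hP)
    · exfalso
      obtain ⟨Ri, hRi, hεi⟩ := run_of_level_digitOneP he hle1 hr₀ hr₀pos hgood hk hR₀ h0' hrun
        (fun i hi => ⟨(hpre i hi).1, (hpre i hi).2.1⟩) i₁ (by omega) le_rfl
      rw [hzero, phiQ_zero, zero_add] at hεi
      have hlow : IsLowerClass X₀ (εs (i₁ + 1)) := by
        rw [hεi]; exact isLowerClass_of_resInP X₀ hF₀ hr₀ hR₀ hgood he hle₀ hG₀ hvis hRi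
      exact hnl (isLowerClass_run_of_levelP he hle1 X₀ hrun hlow (M + 1) (by omega) le_rfl)

/-! ## §3 THE REDUCTION: the `n = 1` slice of ⟨`Rescue.FiniteSupportStaysInBox_ours p`⟩ from in-box exhaustion of one-variable reduced runs -/

/-- **At `p = 2` the hypothesis `hex` below is res-L1-type-o6's death theorem** `ReducedRun.reduced_exhaustion_of_two_le_order` (which even gives
ONE death index and ALL large depths, more than the «infinitely many p-power depths» asked): so `carrierStaysInBox_coe_fin_one_of_reduced_exhaustion 2 (reduced_exhaustion_eventually_two)` is
`ReducedBridge.carrierStaysInBox_coe_fin_one_level` again. [folklore] -/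
theorem reduced_exhaustion_eventually_two {L : Type} [Field L] [CharP L 2] (G : PowerSeries L)
    (hfin : ∃ B : ℕ, ∀ m, B < m → PowerSeries.coeff m G = 0) (h2 : (2 : ℕ∞) ≤ PowerSeries.order G) :
    ∀ a₀ : ℕ, ∃ a : ℕ, a₀ ≤ a ∧ ∃ i₁ : ℕ,
      (∀ i < i₁, ReducedRun.canonRun (2 ^ a) G i ≠ 0 ∧ (2 : ℕ∞) ≤ PowerSeries.order (ReducedRun.canonRun (2 ^ a) G i) ∧
        PowerSeries.order (ReducedRun.canonRun (2 ^ a) G i) < ((2 ^ a : ℕ) : ℕ∞)) ∧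
      ReducedRun.canonRun (2 ^ a) G i₁ = 0 := by
  obtain ⟨i₁, Bstar, h⟩ := ReducedRun.reduced_exhaustion_of_two_le_order G hfin h2
  exact fun a₀ => ⟨max a₀ Bstar, le_max_left _ _, i₁, h (2 ^ max a₀ Bstar) (lt_of_le_of_lt (le_max_right _ _) Nat.lt_two_pow_self)⟩


/-- **THE `n = 1` SLICE AT PRIME `p`, REDUCED.** Let `K` be a field of characteristic `p` (`[ExpChar K p] [PerfectRing K p]`, the binders of the
OURS premise). HYPOTHESIS `hex` (OURS reduced model, res-L1-k24's `canonRun`): every finitely supported `G ∈ K⟦t⟧` with `2 ≤ ord G` is EXHAUSTED IN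
BOX at INFINITELY MANY `p`-power depths — `∀ a₀, ∃ a ≥ a₀, ∃ i₁, (∀ i < i₁, canonRun p^a G i ≠ 0 ∧ 2 ≤ ord (canonRun p^a G i) < p^a) ∧ canonRun p^a G i₁ = 0`
(sharp: the companion `…PEscape` shows escapes at ALL large `p`-power depths refute the premise).
CONCLUSION: `Rescue.CarrierStaysInBox p e ↑P` for EVERY level `e` and EVERY polynomial `P ∈ K[x]`. Decomposition by the reference datum `X₀`:
`r₀ := α + pβ` (top residue, `< q`, not `≡ 0 mod p`), `G :=` the residue-`r₀` class of `P` read in `x^q` (`≠ 0`, `G(0) = 0` from `q < ord P`,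
finitely supported), `R := P − x^{r₀}G(x^q)` (passenger: residues visible in `P`, base-`p` digit pairs below `(α, β)`); bottom digit `≥ 2`:
`hex` for `G`; bottom digit `1`: the forced Case-(III) step, then `hex` for `univStepIIIq k̄ G` (`k̄ = q / r₀ + 1`, order `≥ 2`, finite support).
At `p = 2`, `hex` is res-L1-type-o6's theorem and this is `ReducedBridge.carrierStaysInBox_coe_fin_one_level`; at odd `p`, `hex` is OPEN (death is
false there — res-type-059's immortal runs — but in-box exhaustion is what is needed). OURS objects; nothing about the manuscript. [folklore] -/
theorem carrierStaysInBox_coe_fin_one_of_reduced_exhaustion (p : ℕ) [hp : Fact p.Prime] [CharP K p] [ExpChar K p] [PerfectRing K p]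
    (hex : ∀ G : PowerSeries K, (∃ B : ℕ, ∀ m, B < m → PowerSeries.coeff m G = 0) → (2 : ℕ∞) ≤ PowerSeries.order G →
      ∀ a₀ : ℕ, ∃ a : ℕ, a₀ ≤ a ∧ ∃ i₁ : ℕ,
        (∀ i < i₁, ReducedRun.canonRun (p ^ a) G i ≠ 0 ∧ (2 : ℕ∞) ≤ PowerSeries.order (ReducedRun.canonRun (p ^ a) G i) ∧
          PowerSeries.order (ReducedRun.canonRun (p ^ a) G i) < ((p ^ a : ℕ) : ℕ∞)) ∧
        ReducedRun.canonRun (p ^ a) G i₁ = 0)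
    (e : ℕ) (P : MvPolynomial (Fin 1) K) : Rescue.CarrierStaysInBox p e (P : MvPowerSeries (Fin 1) K) := by
  intro ℓ₀ X₀ he hle h0 hα hord
  have htop := mem_topBlock.mp (bot_mem X₀ h0)
  have hts : (alpha X₀.support X₀.u, beta X₀.support X₀.u, gammaStar X₀.support X₀.u) ∈ X₀.support := (mem_effSupport.mp htop.1).1
  set r₀ : ℕ := alpha X₀.support X₀.u 0 + p * beta X₀.support X₀.u 0 with hr₀def
  have hr₀ : r₀ < p ^ e := digits_ltP X₀ he hts
  obtain ⟨hdm, hdd⟩ : r₀ % p = alpha X₀.support X₀.u 0 ∧ r₀ / p = beta X₀.support X₀.u 0 :=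
    digit_mod_div hp.out.pos (X₀.a_lt _ hts 0)
  have hr₀pos : 0 < r₀ := by
    have hne : alpha X₀.support X₀.u 0 ≠ 0 := fun h =>
      hα (by rw [eq_single (alpha X₀.support X₀.u), h, Finsupp.single_zero])
    by_contra h0'
    exact hne (by rw [← hdm]; simp [Nat.eq_zero_of_not_pos h0'])
  have hαe : alpha X₀.support X₀.u = Finsupp.single 0 (r₀ % p) := by rw [eq_single (alpha X₀.support X₀.u), hdm]
  have hβe : beta X₀.support X₀.u = Finsupp.single 0 (r₀ / p) := by rw [eq_single (beta X₀.support X₀.u), hdd]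
  set G : PowerSeries K := PowerSeries.mk fun m =>
    MvPowerSeries.coeff (Finsupp.single 0 (r₀ + p ^ e * m)) (P : MvPowerSeries (Fin 1) K) with hG
  set R : MvPowerSeries (Fin 1) K := (P : MvPowerSeries (Fin 1) K) - phiQ (p ^ e) (ppow_ne_zero p e) r₀ G with hR
  have hF : (P : MvPowerSeries (Fin 1) K) = phiQ (p ^ e) (ppow_ne_zero p e) r₀ G + R := by rw [hR, add_sub_cancel]
  have hres : ∀ d : Fin 1 →₀ ℕ, MvPowerSeries.coeff d (P : MvPowerSeries (Fin 1) K) ≠ 0 →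
      d 0 % p ^ e = r₀ ∨ PairLTP p (d 0 % p ^ e) r₀ := by
    intro d hd
    obtain ⟨s, hs, r, hr⟩ := exists_mem_effSupport_of_coeff_ne_zero hle X₀ hd
    have hss := (mem_effSupport.mp hs).1
    rw [residue_of_eqP X₀ he hss hr]
    have hk := pairKey_le_top hs
    rw [hαe, hβe] at hk
    exact eq_or_pairLTP_of_pairKey_leP X₀ hss hk
  have hRin : ResIn (p ^ e)
      (fun ρ => PairLTP p ρ r₀ ∧ ∃ d : Fin 1 →₀ ℕ, MvPowerSeries.coeff d (P : MvPowerSeries (Fin 1) K) ≠ 0 ∧ d 0 % p ^ e = ρ) R := by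
    intro d hd
    by_cases hdr : d 0 % p ^ e = r₀
    · exfalso
      apply hd
      rw [hR, map_sub, coeff_phiQ_of_lt _ hr₀, if_pos hdr, hG, PowerSeries.coeff_mk]
      have hd' : Finsupp.single (0 : Fin 1) (r₀ + p ^ e * (d 0 / p ^ e)) = d := by
        conv_rhs => rw [eq_single d]
        congr 1
        rw [← hdr]
        exact Nat.mod_add_div _ _
      rw [hd', sub_self]
    · have hdF : MvPowerSeries.coeff d (P : MvPowerSeries (Fin 1) K) ≠ 0 := by
        rwa [hR, map_sub, coeff_phiQ_of_lt _ hr₀, if_neg hdr, sub_zero] at hd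
      exact ⟨(hres d hdF).resolve_left hdr, d, hdF, rfl⟩
  have hgood : ∀ ρ, (PairLTP p ρ r₀ ∧ ∃ d : Fin 1 →₀ ℕ, MvPowerSeries.coeff d (P : MvPowerSeries (Fin 1) K) ≠ 0 ∧ d 0 % p ^ e = ρ) →
      PairLTP p ρ r₀ := fun ρ h => h.1
  have hvis : ∀ ρ, (PairLTP p ρ r₀ ∧ ∃ d : Fin 1 →₀ ℕ, MvPowerSeries.coeff d (P : MvPowerSeries (Fin 1) K) ≠ 0 ∧ d 0 % p ^ e = ρ) →
      ∃ d : Fin 1 →₀ ℕ, MvPowerSeries.coeff d (P : MvPowerSeries (Fin 1) K) ≠ 0 ∧ d 0 % p ^ e = ρ := fun ρ h => h.2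
  have hGne : G ≠ 0 := by
    obtain ⟨m, hm, hmod⟩ := TopDeriv.exists_coeff_ne_zero_of_mem_effSupport he hle X₀ htop.1
    have hmr : m 0 % p ^ e = r₀ := Eq.trans (hmod 0) (expo_modP X₀ he hts)
    intro hG0
    apply hm
    rw [hF, map_add, coeff_phiQ_of_lt _ hr₀, if_pos hmr, hG0, map_zero, zero_add]
    exact hRin.coeff_eq_zero fun h => (hgood _ h).ne hmr
  have hG00 : PowerSeries.constantCoeff G = 0 := by
    by_contra hc
    rw [adicOrder_eq_order] at hord
    have hcoeff : MvPowerSeries.coeff (Finsupp.single 0 (r₀ + p ^ e * 0)) (P : MvPowerSeries (Fin 1) K) ≠ 0 := by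
      rwa [coeff_top_residueP hF hr₀ hRin hgood, PowerSeries.coeff_zero_eq_constantCoeff_apply]
    have hle' := MvPowerSeries.order_le hcoeff
    rw [Finsupp.degree_single, mul_zero, add_zero] at hle'
    have h1 : ((p ^ e : ℕ) : ℕ∞) < (r₀ : ℕ∞) := lt_of_lt_of_le hord hle'
    exact absurd (by exact_mod_cast h1 : p ^ e < r₀) (by omega)
  have hGfin : ∃ B : ℕ, ∀ m, B < m → PowerSeries.coeff m G = 0 := by
    refine ⟨P.totalDegree, fun m hm => ?_⟩
    rw [hG, PowerSeries.coeff_mk]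
    refine coeff_coe_eq_zero_of_totalDegree_lt P _ ?_
    rw [Finsupp.single_eq_same]
    have h1 : m ≤ p ^ e * m := Nat.le_mul_of_pos_left m (pow_pos hp.out.pos e)
    omega
  by_cases hc1 : PowerSeries.coeff 1 G = 0
  · -- bottom digit `≥ 2`: `hex` for `G`
    have h2 : (2 : ℕ∞) ≤ PowerSeries.order G := PowerSeries.nat_le_order _ _ fun i hi => by
      interval_cases i
      · rw [PowerSeries.coeff_zero_eq_constantCoeff]; exact hG00
      · exact hc1
    obtain ⟨a, ha, i₁, hpre, hzero⟩ := hex G hGfin h2 ℓ₀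
    refine ⟨e + a, by omega, ?_⟩
    have hae : e + a - e = a := by omega
    refine staysInBox_of_level_of_reduced_exhaustionP he (by omega) hr₀ hgood hGne X₀ hF hRin hle hvis (i₁ := i₁) ?_ ?_
    · rw [hae]; exact hpre
    · rw [hae]; exact hzero
  · -- bottom digit `1`: the Case-(III) step, then `hex` for the second state
    have hk : PowerSeries.order G = (1 : ℕ) := PowerSeries.order_eq_nat.mpr ⟨hc1, fun i hi => by
      interval_cases i
      rw [PowerSeries.coeff_zero_eq_constantCoeff]; exact hG00⟩
    obtain ⟨B, hB⟩ := hGfin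
    set kb := p ^ e / r₀ + 1 with hkb
    set G₁ := ReducedRun.univStepIIIq kb G with hG₁
    obtain ⟨a, ha, i₁, hpre, hzero⟩ := hex G₁ ⟨(2 ^ kb + 1) * B, ReducedRun.coeff_univStepIIIq_eq_zero_of_bound hB⟩
      (ReducedRun.two_le_order_univStepIIIq kb hG00) (max ℓ₀ (B + 1))
    refine ⟨e + a, by omega, ?_⟩
    have hae : e + a - e = a := by omega
    have hBP : B < p ^ a := lt_of_lt_of_le (Nat.lt_pow_self hp.out.one_lt) (Nat.pow_le_pow_right hp.out.pos (show B ≤ a by omega))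
    have hcanon : ReducedRun.canonStepIIIq (p ^ (e + a - e)) kb G = G₁ := by
      rw [hae]; exact ReducedRun.canonStepIIIq_eq_univStepIIIq fun m hm => hB m (by omega)
    refine staysInBox_of_level_of_reduced_exhaustion_digitOneP he (by omega) hr₀ hr₀pos hgood hk X₀ hF hRin hle hvis (i₁ := i₁) ?_ ?_
    · intro i hi
      rw [hcanon, hae]
      exact hpre i hi
    · rw [hcanon, hae]; exact hzero

end ReducedBridgeP

end CampaignW24

end Summit.ResolutionOfSingularities.ResolutionOfSingularities.Theorems

end
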